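import Summits.CriticalPhenomena.PercolationContinuityZ3.Theorems.Transplant.FKConnectivityAllQAntipodalTwoSpineCells
import Summits.CriticalPhenomena.PercolationContinuityZ3.Theorems.Transplant.FKConnectivityAllQAntipodalTwoSpineGround
import Summits.CriticalPhenomena.PercolationContinuityZ3.Theorems.Transplant.FKConnectivityAllQAntipodalX2SpineRows
import HarnessLib

/-!
# Connectivity correlation inequalities for `φ_{w,q}` — TWO-SPINE word model: rows of GROUND words; the critical cells and their R2 targets

Helper file (`--supports stmt-CriticalPhenomena-4575`), FK sub-lane `prim-bschramm-fk-2` (gen 15); builds on p205010 (kernel theorem,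
internal audit signed; external expert review pending).  No named facts, no sorries, standard axioms.

Memo `bschramm/FROM-fk-2-g15-TWO-SPINE.md` §12 (V2) / blueprint L2: the `γ`-row of a ground word is all walls and its `γᶜ`-row all particles,
so (i) a critical `j = true` cell `(u, v, true)` (ground `v`) has sign `-[rowC ᾱ]` — it is a loser iff `ᾱ` conducts
(`cellSign_true_ground`); (ii) the R2 target `(u', v.map swapLetter, false)` has sign `[rowC α']` — a winner iff `α'` conducts
(`cellSign_false_swap_ground`); (iii) the `B`-flag and the total `corr` of the `B`-word are unchanged by the row exchange
(`cellDelB_swap`, `rowCorr_swap`).  Together with Theorem U on `A∖y` (`phiRun (false,false)`) and gen 13's `sigma_wordHall` on the `A`-word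
this is the bookkeeping of the atom moves of the two-spine rule.
[cite: Grimmett2006, §3.8 (pp. 61–62); §3.9 (p. 63)]
-/

namespace Summit.CriticalPhenomena.PercolationContinuityZ3.Theorems

namespace FK

namespace TwoSpine

open X2Word

/-! ### Rows of a ground word -/

/-- The `γ`-row of a ground word consists of walls only. [folklore] -/
theorem sRowA_ground_allW {v : List SLetter} (hv : isGround v = true) : ∀ k ∈ sRowA v, k = Kind.W := by
  induction v with
  | nil => simp
  | cons l v ih =>
    have hl : groundLetter l = true := by simp [isGround] at hv; exact hv.1
    have hv' : isGround v = true := by simp [isGround] at hv ⊢; exact hv.2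
    rw [sRowA_cons]
    intro k hk
    rcases List.mem_append.1 hk with h1 | h2
    · obtain ⟨kk, b, bb⟩ := l
      cases kk <;> cases b <;> cases bb <;> simp_all [sVisA, groundLetter]
    · exact ih hv' k h2

/-- The `γᶜ`-row of a ground word consists of particles only. [folklore] -/
theorem sRowB_ground_allP {v : List SLetter} (hv : isGround v = true) : ∀ k ∈ sRowB v, k = Kind.P := by
  induction v with
  | nil => simp
  | cons l v ih =>
    have hl : groundLetter l = true := by simp [isGround] at hv; exact hv.1
    have hv' : isGround v = true := by simp [isGround] at hv ⊢; exact hv.2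
    rw [sRowB_cons]
    intro k hk
    rcases List.mem_append.1 hk with h1 | h2
    · obtain ⟨kk, b, bb⟩ := l
      cases kk <;> cases b <;> cases bb <;> simp_all [sVisB, groundLetter]
    · exact ih hv' k h2

/-- A row of walls does not conduct. [folklore] -/
theorem rowC_of_allW {row : List Kind} (h : ∀ k ∈ row, k = Kind.W) : rowC row = false := by
  unfold rowC lastP
  cases hrow : row.getLast? with
  | none => simp
  | some k =>
    have hk : k ∈ row := List.mem_of_getLast? hrow
    simp [h k hk]

/-- A row of particles conducts once the marked edge is inserted (`rowCdot`), whether empty or not. [folklore] -/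
theorem rowCdot_of_allP {row : List Kind} (h : ∀ k ∈ row, k = Kind.P) : rowCdot row = true := by
  unfold rowCdot lastP
  cases hrow : row.getLast? with
  | none => simp [List.getLast?_eq_none_iff.1 hrow]
  | some k =>
    have hk : k ∈ row := List.mem_of_getLast? hrow
    simp [h k hk]

/-! ### The critical cells and their R2 targets (memo §12 V2) -/

/-- **A critical `j = true` cell is a loser iff `ᾱ` conducts**: with a ground `B`-word, `cellSign true u v = -[rowC ᾱ]`. [folklore] -/
theorem cellSign_true_ground {v : List SLetter} (hv : isGround v = true) (u : List SLetter) :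
    cellSign true u v = -bR (rowC (sRowB u)) := by
  unfold cellSign
  rw [rowC_of_allW (sRowA_ground_allW hv), rowCdot_of_allP (sRowB_ground_allP hv)]
  simp [bR]

/-- **The R2 target is a winner iff `α'` conducts**: against the row exchange of a ground word, `cellSign false u' (v.map swapLetter) = [rowC α']`. [folklore] -/
theorem cellSign_false_swap_ground {v : List SLetter} (hv : isGround v = true) (u' : List SLetter) :
    cellSign false u' (v.map swapLetter) = bR (rowC (sRowA u')) := by
  unfold cellSign
  rw [sRowA_map_swapLetter, sRowB_map_swapLetter, rowCdot_of_allP (sRowB_ground_allP hv), rowC_of_allW (sRowA_ground_allW hv)]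
  simp [bR]

/-- The `B`-flag of the cell is unchanged by the R2 move: `cellDelB false (v.map swapLetter) = cellDelB true v`. [folklore] -/
theorem cellDelB_swap (v : List SLetter) : cellDelB false (v.map swapLetter) = cellDelB true v := by
  simp [cellDelB, sRowA_map_swapLetter]

/-- The total `corr` of the `B`-word is unchanged by the row exchange. [folklore] -/
theorem rowCorr_swap (v : List SLetter) :
    rowCorr (sRowA (v.map swapLetter)) + rowCorr (sRowB (v.map swapLetter)) = rowCorr (sRowA v) + rowCorr (sRowB v) := by
  rw [sRowA_map_swapLetter, sRowB_map_swapLetter, Nat.add_comm]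

end TwoSpine

end FK

end Summit.CriticalPhenomena.PercolationContinuityZ3.Theorems
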